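import Summits.HubbardSuperconductivity.HubbardSuperconductivity.Theorems.WindowInfraredBound.Negative.SaturatedFerromagnet
import Summits.HubbardSuperconductivity.HubbardSuperconductivity.Theorems.KacWindowPenaltyWindowGapNormalForms
import Summits.HubbardSuperconductivity.HubbardSuperconductivity.Theorems.BalabanIRBirEveryGroundStateSchur
import Summits.HubbardSuperconductivity.HubbardSuperconductivity.Theorems.DeformationLadderLowEnergyRigidityTelescopeNormalForms

/-!
# Crux `WindowGap` (stmt-HubbardSuperconductivity-1088), negative side: NO WITNESS IN A SATURATED
# FERROMAGNET (line lead c3, 2026-08-16)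

The sibling crux's negative `WindowInfraredBound/Negative/SaturatedFerromagnet.lean` records that every
pair Fourier mode annihilates a saturated ferromagnet (`pairFieldAt_mulVec_eq_zero_of_saturated`: an
`N`-particle `ψ` with `S²ψ = (N/2)(N/2+1)ψ` has `Δ_g(m)ψ = 0` for every `m`, the singlet pair operator
being a spin scalar; Tasaki 1998). For THIS crux the consequence is on the other side of the ledger: at
such a sector ground state the Kac-window penalty is invisible, so the penalised sector energy does not
move at all —

* `kacWindow_mulVec_eq_zero_of_saturated` — `W_ε ψ = 0` (literal window of the route, any `g`, `ε`);
* `penalised_minEnergyOn_eq_of_saturatedGS` — if some unit GROUND STATE `ψ` of `hubbardTorus 2 L 1 U` in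
  `szSector N M` is saturated, then `minEnergyOn (H + λW_ε) (szSector N M) = minEnergyOn H (szSector N M)`
  for every `λ ≥ 0` and every `ε` (`≤` by the variational principle at `ψ`, `≥` since `W_ε ≥ 0`);
* `not_windowGapIneq_of_saturatedGS` — hence the crux inequality `λ(Cε + a)L² ≤ gap_L` FAILS at that `L`
  whenever `λ > 0` and `Cε + a > 0`;
* `not_windowGapAt_of_frequently_saturatedGS` — so at a parameter point `(U, δ)` where saturated
  (Nagaoka-type) sector ground states occur for arbitrarily large even `L`, the crux BODY is false for
  every `C ≥ 0`, `ε₀ > 0`: a witness `(U, δ)` of `KacWindowPenalty.WindowGap` must avoid the finite-density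
  ferromagnetic corner (large `U`, small `δ`) — conjectural for the pure square-lattice model, rigorous only
  for one hole at `U = ∞` (Nagaoka 1966; Tasaki 1998), so this is a CONDITIONAL exclusion, the companion of
  the `U = 0` exclusion `not_windowGapAt_zero` (p118873) at the opposite corner.

No definitions, no named facts; `--supports stmt-HubbardSuperconductivity-1088`.
Sources: Y. Nagaoka, Phys. Rev. 147 (1966) 392; H. Tasaki, Prog. Theor. Phys. 99 (1998) 489, pp. 20–21;
H. Tasaki (2020) §2.1 (variational principle). Folklore finite-dimensional statements.
Tree search: `WindowInfraredBound.Negative.pairFieldAt_mulVec_eq_zero_of_saturated`,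
`re_dotProduct_kacWindow_mulVec_nonneg`, `minEnergyOn_le_re_rayleigh`,
`LowEnergyRigidity.Telescope.le_minEnergyOn_of_forall_unit`, `mem_szSector_iff`.
-/

-- the mandated namespace repeats `HubbardSuperconductivity` (single-problem summit, D-0017)
set_option linter.dupNamespace false

noncomputable section

namespace Summit.HubbardSuperconductivity.HubbardSuperconductivity.Theorems.WindowGap.Negative

open Matrix Finset Literature.MathematicalPhysics.QuantumLattice Literature.Probability.LatticeModels
open scoped ComplexOrder ComplexConjugate

variable {L : ℕ} [NeZero L]

/-- **The Kac window is invisible on a saturated ferromagnet**: `W_ε ψ = 0` for an `N`-particle `ψ` of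
maximal total spin (every `Δ_g(m)ψ = 0`). Tasaki, Prog. Theor. Phys. 99 (1998) 489, p. 20. [folklore] -/
theorem kacWindow_mulVec_eq_zero_of_saturated (g : Site 2 → ℝ) (ε : ℝ) {N : ℕ}
    {ψ : Fock (Orb (FermionTorus 2 L))} (hN : IsNParticle N ψ)
    (hS : spinSq *ᵥ ψ = (((N : ℝ) / 2 * ((N : ℝ) / 2 + 1) : ℝ) : ℂ) • ψ) :
    (∑ m : Fin 2 → ZMod L,
        if (2 * Real.pi / (L : ℝ)) ^ 2 * (∑ i : Fin 2, (((m i).valMinAbs : ℤ) : ℝ) ^ 2) ≤ ε ^ 2 then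
          ((L : ℂ) ^ 2)⁻¹ • (Matrix.conjTranspose (pairFieldAt g L m) * pairFieldAt g L m)
        else 0) *ᵥ ψ = 0 := by
  rw [Matrix.sum_mulVec]
  refine Finset.sum_eq_zero fun m _ => ?_
  split_ifs
  · rw [Matrix.smul_mulVec, ← mulVec_mulVec,
      WindowInfraredBound.Negative.pairFieldAt_mulVec_eq_zero_of_saturated g L m hN hS, mulVec_zero,
      smul_zero]
  · rw [zero_mulVec]

/-- **A saturated sector ground state freezes the penalised energy.** If a unit ground state `ψ` of
`H = hubbardTorus 2 L 1 U` in `szSector N M` has maximal total spin, then for every `λ ≥ 0` and every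
window radius `ε`: `minEnergyOn (H + λW_ε) (szSector N M) = minEnergyOn H (szSector N M)` — `≤` by the
variational principle at `ψ` (`W_ε ψ = 0`), `≥` because `W_ε ≥ 0`. Tasaki (2020) §2.1. [folklore] -/
theorem penalised_minEnergyOn_eq_of_saturatedGS (U : ℝ) {N : ℕ} {M : ℝ} (ε : ℝ) {lam : ℝ}
    (hlam : 0 ≤ lam) {ψ : Fock (Orb (FermionTorus 2 L))} (hψ1 : star ψ ⬝ᵥ ψ = 1)
    (hgs : IsGroundStateInSector (hubbardTorus 2 L 1 U) N M ψ)
    (hS : spinSq *ᵥ ψ = (((N : ℝ) / 2 * ((N : ℝ) / 2 + 1) : ℝ) : ℂ) • ψ) :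
    (hubbardTorus 2 L 1 U + (lam : ℂ) • (∑ m : Fin 2 → ZMod L,
        if (2 * Real.pi / (L : ℝ)) ^ 2 * (∑ i : Fin 2, (((m i).valMinAbs : ℤ) : ℝ) ^ 2) ≤ ε ^ 2 then
          ((L : ℂ) ^ 2)⁻¹ • (Matrix.conjTranspose (pairFieldAt dWaveFormFactor L m) *
            pairFieldAt dWaveFormFactor L m)
        else 0)).minEnergyOn (szSector N M) =
      (hubbardTorus 2 L 1 U).minEnergyOn (szSector N M) := by
  obtain ⟨hψK, -, hHψ⟩ := hgs
  have hN : IsNParticle N ψ := ((mem_szSector_iff _ _ _).1 hψK).1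
  have hE : (star ψ ⬝ᵥ (hubbardTorus 2 L 1 U *ᵥ ψ)).re =
      (hubbardTorus 2 L 1 U).minEnergyOn (szSector N M) := by
    rw [hHψ, dotProduct_smul, smul_eq_mul, hψ1, mul_one, Complex.ofReal_re]
  refine le_antisymm ?_ ?_
  · refine (minEnergyOn_le_re_rayleigh _ _ hψK hψ1).trans (le_of_eq ?_)
    rw [add_mulVec, dotProduct_add, Matrix.smul_mulVec, dotProduct_smul,
      kacWindow_mulVec_eq_zero_of_saturated dWaveFormFactor ε hN hS, dotProduct_zero, smul_zero,
      add_zero, hE]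
  · refine LowEnergyRigidity.Telescope.le_minEnergyOn_of_forall_unit _ _ ⟨ψ, hψK, hψ1⟩
      fun φ hφK hφ1 => ?_
    rw [add_mulVec, dotProduct_add, Matrix.smul_mulVec, dotProduct_smul, Complex.add_re, smul_eq_mul,
      Complex.re_ofReal_mul]
    have h1 := minEnergyOn_le_re_rayleigh (hubbardTorus 2 L 1 U) _ hφK hφ1
    have h2 := re_dotProduct_kacWindow_mulVec_nonneg L ε φ
    nlinarith

/-- **The crux inequality fails at a side with a saturated sector ground state**: with `ψ` as above,
`λ > 0` and `Cε + a > 0`, `¬ λ(Cε + a)L² ≤ minEnergyOn (H + λW_ε) K − minEnergyOn H K` (the right side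
is `0`). [folklore] -/
theorem not_windowGapIneq_of_saturatedGS (U : ℝ) {N : ℕ} {M : ℝ} {C ε lam a : ℝ} (hlam : 0 < lam)
    (hCa : 0 < C * ε + a) {ψ : Fock (Orb (FermionTorus 2 L))} (hψ1 : star ψ ⬝ᵥ ψ = 1)
    (hgs : IsGroundStateInSector (hubbardTorus 2 L 1 U) N M ψ)
    (hS : spinSq *ᵥ ψ = (((N : ℝ) / 2 * ((N : ℝ) / 2 + 1) : ℝ) : ℂ) • ψ) :
    ¬ lam * (C * ε + a) * (L : ℝ) ^ 2 ≤
      (hubbardTorus 2 L 1 U + (lam : ℂ) • (∑ m : Fin 2 → ZMod L,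
          if (2 * Real.pi / (L : ℝ)) ^ 2 * (∑ i : Fin 2, (((m i).valMinAbs : ℤ) : ℝ) ^ 2) ≤ ε ^ 2 then
            ((L : ℂ) ^ 2)⁻¹ • (Matrix.conjTranspose (pairFieldAt dWaveFormFactor L m) *
              pairFieldAt dWaveFormFactor L m)
          else 0)).minEnergyOn (szSector N M) -
        (hubbardTorus 2 L 1 U).minEnergyOn (szSector N M) := by
  rw [penalised_minEnergyOn_eq_of_saturatedGS U ε hlam.le hψ1 hgs hS, sub_self, not_le]
  have hL : (0 : ℝ) < (L : ℝ) ^ 2 := by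
    have : (0 : ℝ) < L := Nat.cast_pos.2 (Nat.pos_of_ne_zero (NeZero.ne L))
    positivity
  positivity

/-- **No witness of `WindowGap` in a saturated-ferromagnetic corner.** If at `(U, δ)` saturated
(maximal total spin) normalised sector ground states of `hubbardTorus 2 L 1 U` in the summit's sector
`(2⌊(1-δ)L²/2⌋, S^z = 0)` occur for arbitrarily large EVEN sides `L`, then the body of the crux
`KacWindowPenalty.WindowGap` at `(U, δ)` is false — for every `C ≥ 0` and `ε₀ > 0` there are NO
`ε ∈ (0, ε₀]`, `λ, a > 0`, `L₀` with `λ(Cε + a)L² ≤ minEnergyOn (H_L + λW_ε) K_L − minEnergyOn H_L K_L`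
for all even `L ≥ L₀`. A conditional exclusion of the (conjectural) finite-density Nagaoka corner, the
companion of the unconditional `U = 0` exclusion `not_windowGapAt_zero`.
Nagaoka, Phys. Rev. 147 (1966) 392; Tasaki, Prog. Theor. Phys. 99 (1998) 489. [folklore] -/
theorem not_windowGapAt_of_frequently_saturatedGS {U δ : ℝ}
    (hFM : ∀ L₀ : ℕ, ∃ (L : ℕ) (_ : NeZero L), L₀ ≤ L ∧ Even L ∧
      ∃ ψ : Fock (Orb (FermionTorus 2 L)), star ψ ⬝ᵥ ψ = 1 ∧
        IsGroundStateInSector (hubbardTorus 2 L 1 U) (2 * ⌊(1 - δ) * (L : ℝ) ^ 2 / 2⌋₊) 0 ψ ∧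
        spinSq *ᵥ ψ = ((((2 * ⌊(1 - δ) * (L : ℝ) ^ 2 / 2⌋₊ : ℕ) : ℝ) / 2 *
          ((((2 * ⌊(1 - δ) * (L : ℝ) ^ 2 / 2⌋₊ : ℕ) : ℝ) / 2) + 1) : ℝ) : ℂ) • ψ)
    {C : ℝ} (hC : 0 ≤ C) {ε₀ : ℝ} (_hε₀ : 0 < ε₀) :
    ¬ ∃ ε ∈ Set.Ioc (0 : ℝ) ε₀, ∃ lam a : ℝ, 0 < lam ∧ 0 < a ∧ ∃ L₀ : ℕ, ∀ (L : ℕ) [NeZero L],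
        L₀ ≤ L → Even L →
          lam * (C * ε + a) * (L : ℝ) ^ 2 ≤
            (hubbardTorus 2 L 1 U + (lam : ℂ) • (∑ m : Fin 2 → ZMod L,
                if (2 * Real.pi / (L : ℝ)) ^ 2 * (∑ i : Fin 2, (((m i).valMinAbs : ℤ) : ℝ) ^ 2) ≤ ε ^ 2
                then ((L : ℂ) ^ 2)⁻¹ • (Matrix.conjTranspose (pairFieldAt dWaveFormFactor L m) *
                  pairFieldAt dWaveFormFactor L m)
                else 0)).minEnergyOn (szSector (2 * ⌊(1 - δ) * (L : ℝ) ^ 2 / 2⌋₊) 0) -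
              (hubbardTorus 2 L 1 U).minEnergyOn (szSector (2 * ⌊(1 - δ) * (L : ℝ) ^ 2 / 2⌋₊) 0) := by
  rintro ⟨ε, hε, lam, a, hlam, ha, L₀, h⟩
  obtain ⟨L, hL, hL₀, hE, ψ, hψ1, hgs, hS⟩ := hFM L₀
  have hCa : 0 < C * ε + a := by nlinarith [hε.1]
  exact not_windowGapIneq_of_saturatedGS U hlam hCa hψ1 hgs hS (h L hL₀ hE)

end Summit.HubbardSuperconductivity.HubbardSuperconductivity.Theorems.WindowGap.Negative
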